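import Summits.QuantumFields.YangMills.Theorems.SwapVirialDeficitBlowUpGnomonicRelationQuaternions
import HarnessLib

/-!
# THE LETTER FLOORS OF THE PRINCIPAL GNOMONIC DEFICIT at every hub `a ≠ 0`, every sign pattern and ALL coordinates
# (second input of the GLOBAL B-TUBE FLOOR; LEAD sfw-p2 g99 ruling 2026-08-31 20:48Z; free-hands support of ⟨stmt-QuantumFields-24197⟩ `SwapVirialDeficit.SwapGluedStiffness`)

With `F̂ = gnoDeficit 0 1 a ε η`, `η = ((x, y), (z, η_F))`, `u = (x₁, x₂)`, `sin ψ = ‖im a‖/‖a‖`: every relation is `≤ 60L³√F̂` in Frobenius norm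
(✓`chartBox_of_chartDeficit`, squared in ✓`comm_frobNorm_sq_le_chartDeficit` ∕ ✓`sigmaRel_frobNorm_sq_le_chartDeficit` ∕ ✓`sum_follower_frobNorm_sq_le_chartDeficit`),
i.e. `‖relation quaternion‖² ≤ 1800L⁶F̂` (✓`fd_sq_eq_two_mul`); combined with the quaternion-level floors of ✓`…GnomonicRelationQuaternions`:
* §5a `bfar_rel_sigma0 ∕ sigma1 ∕ sigma2 ∕ comm02 ∕ comm01` — the five relation quaternions are `≤ 1800L⁶F̂` in squared norm;
* §5b ★★★ THE LETTER FLOORS: `gnoDeficit_floor_z` (`|z|²/(1+|z|²) ≤ 1800L⁶F̂`), `gnoDeficit_floor_yPerp` (`4sin²ψ|y⊥|²/(1+|y|²) ≤ 1800L⁶F̂`),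
  `gnoDeficit_floor_yAxial` (`4((x₂y₀−x₀y₂)² + (x₀y₁−x₁y₀)²)/((1+|x|²)(1+|y|²)) ≤ 1800L⁶F̂`), `gnoDeficit_floor_hubPolar`
  (`16re²‖im‖²|u|²/(‖a‖⁴(1+|x|²)) ≤ 7200L⁶F̂`), `gnoDeficit_floor_tilt` (`16sin²ψ·x₀²|u|²/(1+|x|²)² ≤ 18000L⁶F̂`), `gnoDeficit_floor_followers`
  (`Σ_f|η_f|²/(1+|η_f|²) ≤ 1152L⁶|Fol L|F̂`) — valid at EVERY hub (bulk, tip, end), reusable by every region of skeleton ➎.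

HONEST LABEL: quaternion bookkeeping on landed inequalities; the B-tube law, stubs `stub_B_stiff` ∕ `stub_core_*` ∕ `stub_h001_good`, ⟨24197⟩ ∕ ⟨24194⟩
and every rung are OPEN; own crux ⟨22884⟩ `LargeFieldMassRefinementTail` OPEN (blocked-on ⟨19935⟩); no crux, rung of record or summit is proved; the
Yang–Mills mass gap is NOT proved; no summit is proved by a line.  THEOREMS ONLY (0 `def`, 0 `sorry`), standard axioms.  Width seat ym-line-sfw-p2-w3 g67
(cell ym-idea-1, free hands), `--supports stmt-QuantumFields-24197`.  References: [cite: Luscher1983, §2]; [cite: tHooft1979]; [folklore].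
-/

set_option autoImplicit false

noncomputable section

open MeasureTheory Quaternion
open scoped BigOperators Quaternion
open Literature.MathematicalPhysics.QuantumFieldTheory hiding SU2
open Literature.MathematicalPhysics.QuantumLattice
open Literature.Analysis.Calculus (radialUnit radialUnit_def norm_radialUnit)

namespace Summit.QuantumFields.YangMills.Theorems.SwapVirialDeficit.BlowUpRing

open Summit.QuantumFields.YangMills.Theorems.FemtoTransferGap
open Summit.QuantumFields.YangMills.Theorems.FemtoTransferGap.TT
open Summit.QuantumFields.YangMills.Theorems.FemtoTransferGap.TwoLattice.Flat (fd)
open Summit.QuantumFields.YangMills.Theorems.VirialFluxGap.RingDeficit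
open Summit.QuantumFields.YangMills.Theorems.SwapVirialDeficit.SwapRing
open Summit.QuantumFields.YangMills.Theorems.SwapTwistDeficit.ToronLog (axisPoint)
open Summit.QuantumFields.YangMills.Theorems.SwapVirialDeficit.ZeroModeSigma (norm_axisUnit su2Quat_quatToSU2_eq_radialUnit)
open Summit.QuantumFields.YangMills.Theorems.ToronValleyVolume.Lojasiewicz (fd_sq_eq_two_mul)

variable {L : ℕ} [NeZero L]

/-! ## §5 Chart level: the LETTER FLOORS of the principal deficit at every hub `a ≠ 0` (all sign patterns, all coordinates) -/

omit [NeZero L] in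
/-- From a squared Frobenius box bound to the quaternion bound: `‖V − W‖²_F ≤ 3600L⁶F ⟹ ‖q(V) − q(W)‖² ≤ 1800L⁶F` (✓`fd_sq_eq_two_mul`). [folklore] -/
theorem bfar_quat_sq_le {V W : SU2} {F : ℝ}
    (h : frobNorm (((V : SU2) : Matrix (Fin 2) (Fin 2) ℂ) - ((W : SU2) : Matrix (Fin 2) (Fin 2) ℂ)) ^ 2 ≤ 3600 * (L : ℝ) ^ 6 * F) :
    ‖su2Quat V - su2Quat W‖ ^ 2 ≤ 1800 * (L : ℝ) ^ 6 * F := by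
  have hfd : fd V W = frobNorm (((V : SU2) : Matrix (Fin 2) (Fin 2) ℂ) - ((W : SU2) : Matrix (Fin 2) (Fin 2) ℂ)) := by simp only [fd]
  have e := fd_sq_eq_two_mul V W
  rw [hfd] at e
  linarith

/-! ### §5a The five relation bounds `‖relation‖² ≤ 1800L⁶F̂` read through `su2Quat` -/

/-- (σ0) `‖ẑ − 1‖² ≤ 1800L⁶F̂` at every hub `a ≠ 0`. [cite: Luscher1983, §2] -/
theorem bfar_rel_sigma0 {a : ℍ} (ha : a ≠ 0) (ε : GnoSign L) (η : GnoCoord L) :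
    ‖radialUnit (gnoLetter ε.2.1 η.2.1) - 1‖ ^ 2 ≤ 1800 * (L : ℝ) ^ 6 * gnoDeficit (fun _ => false) (fun _ => 1) a ε η := by
  unfold gnoDeficit
  have h := sigmaRel_frobNorm_sq_le_chartDeficit (L := L) (blowUpPoint (L := L) 1 (gnomonicPoint a ε η)) 0
  rw [Equiv.swap_apply_left] at h
  have h' := bfar_quat_sq_le (L := L) h
  rwa [show (Fin.castSucc (1 : Fin 3) : Fin 4) = 1 from rfl, show (Fin.castSucc (0 : Fin 3) : Fin 4) = 0 from rfl,
    show (Fin.last 3 : Fin 4) = 3 from rfl, norm_sigmaRel_zero_quat ha ε η] at h'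

/-- (σ1) `‖A·x̂ − (Ā·x̂·A·ẑ)·A‖² ≤ 1800L⁶F̂`. [cite: Luscher1983, §2] -/
theorem bfar_rel_sigma1 {a : ℍ} (ha : a ≠ 0) (ε : GnoSign L) (η : GnoCoord L) :
    ‖radialUnit (axisPoint a) * radialUnit (gnoLetter ε.1.1 η.1.1) -
        star (radialUnit (axisPoint a)) * radialUnit (gnoLetter ε.1.1 η.1.1) * radialUnit (axisPoint a) * radialUnit (gnoLetter ε.2.1 η.2.1) *
          radialUnit (axisPoint a)‖ ^ 2 ≤ 1800 * (L : ℝ) ^ 6 * gnoDeficit (fun _ => false) (fun _ => 1) a ε η := by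
  unfold gnoDeficit
  have h := sigmaRel_frobNorm_sq_le_chartDeficit (L := L) (blowUpPoint (L := L) 1 (gnomonicPoint a ε η)) 1
  rw [Equiv.swap_apply_right] at h
  have h' := bfar_quat_sq_le (L := L) h
  rwa [show (Fin.castSucc (1 : Fin 3) : Fin 4) = 1 from rfl, show (Fin.castSucc (0 : Fin 3) : Fin 4) = 0 from rfl,
    show (Fin.last 3 : Fin 4) = 3 from rfl, Balaban1983to89.T4HaarSU2Translate.su2Quat_mul, Balaban1983to89.T4HaarSU2Translate.su2Quat_mul,
    su2Quat_gnoLeader_three ha, su2Quat_gnoLeader_zero, su2Quat_gnoLeader_one ha] at h'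

/-- (σ2) `‖A·ŷ − ŷ·A‖² ≤ 1800L⁶F̂`. [cite: Luscher1983, §2] -/
theorem bfar_rel_sigma2 {a : ℍ} (ha : a ≠ 0) (ε : GnoSign L) (η : GnoCoord L) :
    ‖radialUnit (axisPoint a) * radialUnit (gnoLetter ε.1.2 η.1.2) - radialUnit (gnoLetter ε.1.2 η.1.2) * radialUnit (axisPoint a)‖ ^ 2 ≤
      1800 * (L : ℝ) ^ 6 * gnoDeficit (fun _ => false) (fun _ => 1) a ε η := by
  unfold gnoDeficit
  have h := sigmaRel_frobNorm_sq_le_chartDeficit (L := L) (blowUpPoint (L := L) 1 (gnomonicPoint a ε η)) 2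
  rw [Equiv.swap_apply_of_ne_of_ne (by decide) (by decide)] at h
  have h' := bfar_quat_sq_le (L := L) h
  rwa [show (Fin.castSucc (2 : Fin 3) : Fin 4) = 2 from rfl, show (Fin.last 3 : Fin 4) = 3 from rfl,
    Balaban1983to89.T4HaarSU2Translate.su2Quat_mul, Balaban1983to89.T4HaarSU2Translate.su2Quat_mul,
    su2Quat_gnoLeader_three ha, su2Quat_gnoLeader_two] at h'

/-- (c02) `‖x̂·ŷ − ŷ·x̂‖² ≤ 1800L⁶F̂`. [cite: Luscher1983, §2] -/
theorem bfar_rel_comm02 (a : ℍ) (ε : GnoSign L) (η : GnoCoord L) :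
    ‖radialUnit (gnoLetter ε.1.1 η.1.1) * radialUnit (gnoLetter ε.1.2 η.1.2) - radialUnit (gnoLetter ε.1.2 η.1.2) * radialUnit (gnoLetter ε.1.1 η.1.1)‖ ^ 2 ≤
      1800 * (L : ℝ) ^ 6 * gnoDeficit (fun _ => false) (fun _ => 1) a ε η := by
  unfold gnoDeficit
  have h := comm_frobNorm_sq_le_chartDeficit (L := L) (blowUpPoint (L := L) 1 (gnomonicPoint a ε η)) 0 2
  have h' := bfar_quat_sq_le (L := L) h
  rwa [show (Fin.castSucc (2 : Fin 3) : Fin 4) = 2 from rfl, show (Fin.castSucc (0 : Fin 3) : Fin 4) = 0 from rfl,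
    Balaban1983to89.T4HaarSU2Translate.su2Quat_mul, Balaban1983to89.T4HaarSU2Translate.su2Quat_mul,
    su2Quat_gnoLeader_zero, su2Quat_gnoLeader_two] at h'

/-- (c01) `‖x̂·C₁ − C₁·x̂‖² ≤ 1800L⁶F̂` (`C₁ = Ā·x̂·A·ẑ` as a quaternion). [cite: Luscher1983, §2] -/
theorem bfar_rel_comm01 {a : ℍ} (ha : a ≠ 0) (ε : GnoSign L) (η : GnoCoord L) :
    ‖radialUnit (gnoLetter ε.1.1 η.1.1) *
          (star (radialUnit (axisPoint a)) * radialUnit (gnoLetter ε.1.1 η.1.1) * radialUnit (axisPoint a) * radialUnit (gnoLetter ε.2.1 η.2.1)) -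
        star (radialUnit (axisPoint a)) * radialUnit (gnoLetter ε.1.1 η.1.1) * radialUnit (axisPoint a) * radialUnit (gnoLetter ε.2.1 η.2.1) *
          radialUnit (gnoLetter ε.1.1 η.1.1)‖ ^ 2 ≤ 1800 * (L : ℝ) ^ 6 * gnoDeficit (fun _ => false) (fun _ => 1) a ε η := by
  unfold gnoDeficit
  have h := comm_frobNorm_sq_le_chartDeficit (L := L) (blowUpPoint (L := L) 1 (gnomonicPoint a ε η)) 0 1
  have h' := bfar_quat_sq_le (L := L) h
  rwa [show (Fin.castSucc (1 : Fin 3) : Fin 4) = 1 from rfl, show (Fin.castSucc (0 : Fin 3) : Fin 4) = 0 from rfl,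
    Balaban1983to89.T4HaarSU2Translate.su2Quat_mul, Balaban1983to89.T4HaarSU2Translate.su2Quat_mul,
    su2Quat_gnoLeader_zero, su2Quat_gnoLeader_one ha] at h'

/-- (followers) `Σ_f |η_f|²/(1+|η_f|²) ≤ 1152·L⁶·|Fol L|·F̂`. [cite: Luscher1983, §2] -/
theorem gnoDeficit_floor_followers (a : ℍ) (ε : GnoSign L) (η : GnoCoord L) :
    ∑ i : Fol L, ((η.2.2 i 0) ^ 2 + (η.2.2 i 1) ^ 2 + (η.2.2 i 2) ^ 2) / (1 + ((η.2.2 i 0) ^ 2 + (η.2.2 i 1) ^ 2 + (η.2.2 i 2) ^ 2)) ≤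
      1152 * (L : ℝ) ^ 6 * (Fintype.card (Fol L) : ℝ) * gnoDeficit (fun _ => false) (fun _ => 1) a ε η := by
  unfold gnoDeficit
  have hfol := sum_follower_frobNorm_sq_le_chartDeficit (L := L) (blowUpPoint (L := L) 1 (gnomonicPoint a ε η))
  have key : ∀ i : Fol L, ((η.2.2 i 0) ^ 2 + (η.2.2 i 1) ^ 2 + (η.2.2 i 2) ^ 2) / (1 + ((η.2.2 i 0) ^ 2 + (η.2.2 i 1) ^ 2 + (η.2.2 i 2) ^ 2)) ≤
      (1 / 2 : ℝ) * frobNorm ((((blowUpPoint (L := L) 1 (gnomonicPoint a ε η)).2 i : SU2) : Matrix (Fin 2) (Fin 2) ℂ) - 1) ^ 2 := fun i => by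
    have hfd : fd ((blowUpPoint (L := L) 1 (gnomonicPoint a ε η)).2 i) 1 =
        frobNorm ((((blowUpPoint (L := L) 1 (gnomonicPoint a ε η)).2 i : SU2) : Matrix (Fin 2) (Fin 2) ℂ) - 1) := by
      simp only [fd, OneMemClass.coe_one]
    have e := fd_sq_eq_two_mul ((blowUpPoint (L := L) 1 (gnomonicPoint a ε η)).2 i) 1
    rw [hfd, gnoFollower_eq a ε η i, su2Quat_quatToSU2_eq_radialUnit (gnoLetter_ne_zero _ _), su2Quat_one] at e
    have hge := bfar_norm_radialUnit_gnoLetter_sub_one_sq_ge (ε.2.2 i) (η.2.2 i)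
    rw [gnoFollower_eq a ε η i]
    linarith
  calc ∑ i : Fol L, ((η.2.2 i 0) ^ 2 + (η.2.2 i 1) ^ 2 + (η.2.2 i 2) ^ 2) / (1 + ((η.2.2 i 0) ^ 2 + (η.2.2 i 1) ^ 2 + (η.2.2 i 2) ^ 2))
      ≤ ∑ i : Fol L, (1 / 2 : ℝ) * frobNorm ((((blowUpPoint (L := L) 1 (gnomonicPoint a ε η)).2 i : SU2) : Matrix (Fin 2) (Fin 2) ℂ) - 1) ^ 2 :=
        Finset.sum_le_sum fun i _ => key i
    _ = (1 / 2 : ℝ) * ∑ i : Fol L, frobNorm ((((blowUpPoint (L := L) 1 (gnomonicPoint a ε η)).2 i : SU2) : Matrix (Fin 2) (Fin 2) ℂ) - 1) ^ 2 := by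
        rw [Finset.mul_sum]
    _ ≤ (1 / 2 : ℝ) * (2304 * (L : ℝ) ^ 6 * (Fintype.card (Fol L) : ℝ) *
          chartDeficit L (fun _ => false) (fun _ => 1) (blowUpPoint (L := L) 1 (gnomonicPoint a ε η))) :=
        mul_le_mul_of_nonneg_left hfol (by norm_num)
    _ = _ := by ring

/-! ### §5b The letter floors -/

/-- ★ (z) **THE σ-SLAVING LETTER**: `|z|²/(1+|z|²) ≤ 1800L⁶F̂` — every hub `a ≠ 0`, every sign pattern. [cite: Luscher1983, §2] -/
theorem gnoDeficit_floor_z {a : ℍ} (ha : a ≠ 0) (ε : GnoSign L) (η : GnoCoord L) :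
    ((η.2.1 0) ^ 2 + (η.2.1 1) ^ 2 + (η.2.1 2) ^ 2) / (1 + ((η.2.1 0) ^ 2 + (η.2.1 1) ^ 2 + (η.2.1 2) ^ 2)) ≤
      1800 * (L : ℝ) ^ 6 * gnoDeficit (fun _ => false) (fun _ => 1) a ε η :=
  (bfar_norm_radialUnit_gnoLetter_sub_one_sq_ge ε.2.1 η.2.1).trans (bfar_rel_sigma0 ha ε η)

/-- ★ (y⊥) **THE TRANSVERSE `y`-LETTERS**: `4 sin²ψ·(y₁² + y₂²)/(1+|y|²) ≤ 1800L⁶F̂` (`sin²ψ = ‖im a‖²/‖a‖²`). [cite: Luscher1983, §2] -/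
theorem gnoDeficit_floor_yPerp {a : ℍ} (ha : a ≠ 0) (ε : GnoSign L) (η : GnoCoord L) :
    4 * ‖a.im‖ ^ 2 * ((η.1.2 1) ^ 2 + (η.1.2 2) ^ 2) / (‖a‖ ^ 2 * (1 + ((η.1.2 0) ^ 2 + (η.1.2 1) ^ 2 + (η.1.2 2) ^ 2))) ≤
      1800 * (L : ℝ) ^ 6 * gnoDeficit (fun _ => false) (fun _ => 1) a ε η := by
  rw [← bfar_sigmaRel_two_sq ha ε.1.2 η.1.2]; exact bfar_rel_sigma2 ha ε η

/-- ★ (y₀∧u) **THE AXIAL `y`-LETTER AGAINST THE TRANSVERSE `x`-LETTERS**: `4((x₂y₀−x₀y₂)² + (x₀y₁−x₁y₀)²)/((1+|x|²)(1+|y|²)) ≤ 1800L⁶F̂`.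
[cite: Luscher1983, §2] -/
theorem gnoDeficit_floor_yAxial (a : ℍ) (ε : GnoSign L) (η : GnoCoord L) :
    4 * ((η.1.1 2 * η.1.2 0 - η.1.1 0 * η.1.2 2) ^ 2 + (η.1.1 0 * η.1.2 1 - η.1.1 1 * η.1.2 0) ^ 2) /
        ((1 + ((η.1.1 0) ^ 2 + (η.1.1 1) ^ 2 + (η.1.1 2) ^ 2)) * (1 + ((η.1.2 0) ^ 2 + (η.1.2 1) ^ 2 + (η.1.2 2) ^ 2))) ≤
      1800 * (L : ℝ) ^ 6 * gnoDeficit (fun _ => false) (fun _ => 1) a ε η :=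
  (bfar_comm_zero_two_sq_ge ε.1.1 ε.1.2 η.1.1 η.1.2).trans (bfar_rel_comm02 a ε η)

/-- ★★ (δ) **THE HUB-POLAR WEIGHT AGAINST THE TRANSVERSE `x`-LETTERS**: `16re(a)²‖im a‖²·(x₁² + x₂²)/(‖a‖⁴(1+|x|²)) ≤ 7200L⁶F̂`
(`= 4sin²2ψ·|u|²/(1+|x|²)`; the word `Ā[A², x̂]`). [cite: Luscher1983, §2] -/
theorem gnoDeficit_floor_hubPolar {a : ℍ} (ha : a ≠ 0) (ε : GnoSign L) (η : GnoCoord L) :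
    16 * a.re ^ 2 * ‖a.im‖ ^ 2 * ((η.1.1 1) ^ 2 + (η.1.1 2) ^ 2) / ((‖a‖ ^ 2) ^ 2 * (1 + ((η.1.1 0) ^ 2 + (η.1.1 1) ^ 2 + (η.1.1 2) ^ 2))) ≤
      7200 * (L : ℝ) ^ 6 * gnoDeficit (fun _ => false) (fun _ => 1) a ε η := by
  have hap : axisPoint a ≠ 0 := fun h => by
    have e := bfar_norm_axisPoint_sq a
    rw [h, norm_zero] at e
    exact ha (norm_eq_zero.1 (by nlinarith [norm_nonneg a]))
  have hA1 : ‖radialUnit (axisPoint a)‖ = 1 := norm_radialUnit hap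
  have hx1 : ‖radialUnit (gnoLetter ε.1.1 η.1.1)‖ = 1 := norm_radialUnit (gnoLetter_ne_zero _ _)
  have hle := bfar_sigmaRel_one_norm_le hA1 hx1 (radialUnit (gnoLetter ε.2.1 η.2.1))
  have h1 := pow_le_pow_left₀ (norm_nonneg _) hle 2
  rw [bfar_sqComm_sq ha ε.1.1 η.1.1] at h1
  have q0 := bfar_rel_sigma0 ha ε η
  have q1 := bfar_rel_sigma1 ha ε η
  nlinarith [q0, q1, h1, sq_nonneg (‖radialUnit (axisPoint a) * radialUnit (gnoLetter ε.1.1 η.1.1) -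
      star (radialUnit (axisPoint a)) * radialUnit (gnoLetter ε.1.1 η.1.1) * radialUnit (axisPoint a) * radialUnit (gnoLetter ε.2.1 η.2.1) *
        radialUnit (axisPoint a)‖ - ‖radialUnit (gnoLetter ε.2.1 η.2.1) - 1‖)]

/-- ★★ (x₀) **THE AXIAL TILT OF THE `x`-LETTER AGAINST ITS TRANSVERSE PART**: `16 sin²ψ·x₀²(x₁² + x₂²)/(1+|x|²)² ≤ 18000L⁶F̂`
(the commutator `[C₀, C₁]`). [cite: Luscher1983, §2] -/
theorem gnoDeficit_floor_tilt {a : ℍ} (ha : a ≠ 0) (ε : GnoSign L) (η : GnoCoord L) :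
    16 * ‖a.im‖ ^ 2 * (η.1.1 0) ^ 2 * ((η.1.1 1) ^ 2 + (η.1.1 2) ^ 2) / (‖a‖ ^ 2 * (1 + ((η.1.1 0) ^ 2 + (η.1.1 1) ^ 2 + (η.1.1 2) ^ 2)) ^ 2) ≤
      18000 * (L : ℝ) ^ 6 * gnoDeficit (fun _ => false) (fun _ => 1) a ε η := by
  have hap : axisPoint a ≠ 0 := fun h => by
    have e := bfar_norm_axisPoint_sq a
    rw [h, norm_zero] at e
    exact ha (norm_eq_zero.1 (by nlinarith [norm_nonneg a]))
  have hA1 : ‖radialUnit (axisPoint a)‖ = 1 := norm_radialUnit hap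
  have hx1 : ‖radialUnit (gnoLetter ε.1.1 η.1.1)‖ = 1 := norm_radialUnit (gnoLetter_ne_zero _ _)
  have hP1 : ‖star (radialUnit (axisPoint a)) * radialUnit (gnoLetter ε.1.1 η.1.1) * radialUnit (axisPoint a)‖ = 1 := by
    rw [norm_mul, norm_mul, norm_star, hA1, hx1]; ring
  have hle := bfar_comm_zero_one_norm_le hx1 hP1 (radialUnit (gnoLetter ε.2.1 η.2.1))
  have h1 := pow_le_pow_left₀ (norm_nonneg _) hle 2
  have hge := bfar_comm_conj_sq_ge ha ε.1.1 η.1.1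
  have q0 := bfar_rel_sigma0 ha ε η
  have q1 := bfar_rel_comm01 ha ε η
  nlinarith [q0, q1, h1, hge, sq_nonneg (2 * ‖radialUnit (gnoLetter ε.1.1 η.1.1) *
        (star (radialUnit (axisPoint a)) * radialUnit (gnoLetter ε.1.1 η.1.1) * radialUnit (axisPoint a) * radialUnit (gnoLetter ε.2.1 η.2.1)) -
      star (radialUnit (axisPoint a)) * radialUnit (gnoLetter ε.1.1 η.1.1) * radialUnit (axisPoint a) * radialUnit (gnoLetter ε.2.1 η.2.1) *
        radialUnit (gnoLetter ε.1.1 η.1.1)‖ - ‖radialUnit (gnoLetter ε.2.1 η.2.1) - 1‖)]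

end Summit.QuantumFields.YangMills.Theorems.SwapVirialDeficit.BlowUpRing

end
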